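import Summits.QuantumFields.BalabanUV.Beta.FP.NestedSliceExchange

/-!
# `BalabanUV.Beta.FP.CombSliceUnimodular` — road «FP» for binder row D1, ROUTE T (R-FP-51), RULING **R-FP-52 (2)** (OWNER d1-p3 g16, journal
# [D1P3-G16-RFP52-ADOPT] 2026-08-21T21:55Z): THE MODEL-LEVEL HALF OF «COMB ∕ TREE SLICES ARE UNIMODULAR AGAINST THE RESIDUAL GAUGE GENERATORS,
# `|det(τ_tree · D)| = 1`» — an3's THEOREM R (4) (`gen46/FP-SYM.v1.md` §3) ∕ LEMMA N corollary (N-tree) (`gen76/SXSTEP-AN3.v1.md` §1) AS KERNEL-CHECKED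
# LINEAR ALGEBRA: a square matrix that is TRIANGULAR ALONG A RANKED FOREST with unimodular diagonal (site) blocks has `|det| = 1`; the tree-coordinate slice
# `[0 | 1]` reads the tree rows of the generator matrix; the CURVE form matching the owner's (UNI) hypotheses (`NestedStepLawOneShot`, p307295)

HONEST DEPENDENCY (page 1, mandatory): continuum YM on T⁴ ⇐ BetaPertH ∧ nine spine estimates (0/9 proved); BetaPertH ⇐ (D1) ∧ (D4) ∧ CAP+tail;
G-an2-4 gates asym, D1 and NE2/3/4.  HONEST FRAMING (cell contract, verbatim): «discharging `BetaPertH` makes Bałaban's UV stability UNCONDITIONAL —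
a real constructive-QFT result; it is NOT the continuum limit and NOT the Clay problem.»  ABSOLUTE RULE (cell charter, verbatim): «No internally-minted
statement may enter as a cited fact. Every hypothesis is either kernel-proved in this package or a verbatim quotation of a PUBLISHED theorem with page
reference. The manuscript(s) under audit are NOT citable for their own disputed steps — they are the thing under adjudication; programme-internal
(2001/route/tribunal) claims are never citable.»  THIS MODULE is [folklore] finite-dimensional linear algebra over arbitrary finite index types (Mathlib's
`Matrix.BlockTriangular.det`); no `def`, no `def … : Prop`, nothing cited, 0 sorry.  «not in print; our bookkeeping».

WHY (R-FP-52 (2), verbatim): «by an3 g76's LEMMA N + THEOREM R (4) the one-shot (scale `Lc^{j+m+1}`) ↔ nested (`[τ₂Q₁; τ₁]`) comb-slice exchange factor has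
modulus 1 for every background, hence (SX-STEP) ≡ 0; typed chain: `NestedSliceExchange.secondVar_kkt_slice_change_of_const` (owner, p306639 ✓) ∘
`NestedSliceExchange.det_nestedSlice_mul_gauge'` (LEMMA N core) ∘ «comb slices are unimodular against the residual gauge generators on the torus, `|det τ·D| = 1`»
(THEOREM R (4); a (T-ID)-side finite statement … first refusal leaf-06 …; S-sized: … the comb gauge is the PROJECTOR `E = axEc` (pinned tree bonds, `treePin`),
equivalently bordering by the tree-bond coordinate rows `τ_tree`; the statement is «the tree-bond rows of the linearised gauge action `D_{V₀}` on the residual algebra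
form a square matrix of `|det| = 1`» — triangular along the tree with diagonal `−Ad(V₀(b_last))^θ`, `|det Ad| = 1`)».  The torus INSTANCE (memo `N2B-DESIGN.md` v5.2
§20 (20d), hypothesis (UNI) of `FP/NestedStepLawTorusInstance`: `|det(τ_os·D)| = 1 = |det(τ₁·D₁)|·|det(τ₂·D̄)|`) feeds `secondVar_kkt_slice_change_of_const`'s `hτW`∕`hPW`
with `c = c' = 1`; its index types (`KernelPeriodisationFib.Idx M F` after `RelInvCompression`) are fixed by (ID-0), not here — hence everything below is INDEX-GENERIC,
and the forest is DISPLAYED DATA (`site`, `rk`, `parent`): at the instance, `site` = the non-centre site a tree bond enters, `parent` = its predecessor on the comb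
path toward the block centre (`none` at the centre), `rk` = the comb depth (ℓ¹-distance to the centre); the two structural hypotheses are THEOREM R (1)∕(4):
the tree row of the bond into `x` sees only `λ(x)` and `λ(parent x)` (`hloc`), with diagonal block `−Ad(V₀(b))^{θ'}` (`|det| = 1`; in the colour-stripped literal: `±1`) (`hdiag`).

CONTENT.
* §1 [folklore] **`det_of_forestTriangular`** (any commutative ring; index type `t`, sites `σ`, DISPLAYED forest data `site : t → σ`, `rk : σ → ℕ`,
  `parent : σ → Option σ` with `parent x = some p → rk p < rk x`; locality `M i j ≠ 0 → site j = site i ∨ parent (site i) = some (site j)`):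
  `M.det = ∏ x ∈ univ.image site, (M.toSquareBlock site x).det` — by `Matrix.BlockTriangular.det` for the block map `i ↦ (rk (site i), e (site i))` read in
  `(ℕ ×ₗ Fin |σ|)ᵒᵈ` (`e` an enumeration of `σ`), whose level sets are exactly the sites; **`abs_det_eq_one_of_forestTriangular`** (over `ℝ`: unimodular site
  blocks ⇒ `|M.det| = 1`); the two packagings an instance meets: **`det_of_forestTriangular_scalar`** ∕ **`abs_det_eq_one_of_forestTriangular_scalar`** (`t = σ`,
  colour-stripped: `M.det = ∏ x, M x x`, `|M x x| = 1 ⇒ |det| = 1`; **`abs_det_eq_one_of_gradientRows`**: tree rows = signed gradient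
  `ε x·([s = x] − [parent x = some s])` ⇒ `|det| = 1` — the literal's instance shape) and **`det_of_forestTriangular_prod`** ∕ **`abs_det_eq_one_of_forestTriangular_prod`**
  (`t = σ × κ`, a colour ∕ component index `κ`: the site block is `Matrix.of fun a a' => M (x, a) (x, a')`).
* §2 [folklore] THE TREE-COORDINATE SLICE READS THE TREE ROWS (cap3's `SaddleInverse` §TreePin packing, bonds `o ⊕ t` = non-tree ⊕ tree):
  `fromCols 0 1 * fromRows D_o D_t = D_t` (**`treeSlice_mul_fromRows`**), hence **`abs_det_treeSlice_mul_eq_one`**: `|det([0 | 1] · [D_o; D_t])| = 1` when the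
  tree rows `D_t : Matrix t t ℝ` are forest-triangular with unimodular site blocks — THEOREM R (4) at model level, the (UNI) shape `|det(τ·D)| = 1`.
* §3 [folklore] CURVE FORM = the SHAPE of the owner's (UNI) hypotheses (`NestedStepLawOneShot.secondVar_oneShot_nestedStepLaw`, p307295: `hU₁`∕`hU₂`∕`hU'` =
  `∀ᶠ u in 𝓝 0, |det(M u)| = c`, static comb slices, moving generators): **`eventually_abs_det_eq_one_of_forestTriangular`** (one ranked forest for all `u` ⇒
  `∀ᶠ u, |det(M u)| = 1`, i.e. `c₁ = c₂ = c' = 1`) and **`eventually_abs_det_eq_one_of_gradientRows`** (the colour-stripped literal: nothing moves).  The nested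
  product form `|det([τ₂Q₁;τ₁]·[D₂|D₁])| = c₂·c₁` is the OWNER's `abs_det_nestedSlice_mul_gauge` (LEMMA N′) — not restated.
NOT HERE: the lattice comb forest itself (sites of an `Lc^k`-block ∕ of the torus, `parent` = one step toward the centre, `rk` = depth) and the reading of the
road's packed generator rows in it — the (T-ID)∕(ID-0) instance, typed against `Idx M F` when those rows are displayed (leaf-06 offers it; R-FP-52 holder list).
0 estimates; 0∕4 row-D1 binders; NOT (SX-STEP) on the torus, NOT (T-ID), NOT SDF, NOT D1, NOT BetaPertH, NOT continuum, NOT Clay.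
Provenance: D1 formalisation swarm LEAF PROVER 06, unit b2b-balaban-beta-d1-formalise-leaf-06 gen 16, 2026-08-21 (R-FP-52 (2) first refusal; OWNER SEAT-CLOSING
[D1P3-G16-CLOSE] (2), INBOX [D1P3-G16-INBOX-8]).  No existing file touched.
-/

namespace Summit.QuantumFields.BalabanUV.Beta.FP.CombSliceUnimodular

open Matrix Finset
open scoped BigOperators

/-! ## §1 Determinant of a matrix triangular along a ranked forest -/

section Forest

variable {R : Type*} [CommRing R]
variable {t σ : Type*} [Fintype t] [DecidableEq t] [Fintype σ] [DecidableEq σ]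

/-- [folklore] **A MATRIX TRIANGULAR ALONG A RANKED FOREST HAS DETERMINANT THE PRODUCT OF ITS SITE BLOCKS.**  Index type `t` fibred over sites by
`site : t → σ`; a forest on the sites given by `parent : σ → Option σ` strictly decreasing a rank `rk : σ → ℕ`; the matrix entry `M i j` vanishes unless the
column site is the row site or its parent (THEOREM R (1): «the (x, s) block vanishes unless s = x or s lies … strictly before x»).  Then
`M.det = ∏ x ∈ univ.image site, (M.toSquareBlock site x).det`. -/
theorem det_of_forestTriangular (M : Matrix t t R) (site : t → σ) (rk : σ → ℕ) (parent : σ → Option σ)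
    (hrk : ∀ x p, parent x = some p → rk p < rk x) (hloc : ∀ i j, M i j ≠ 0 → site j = site i ∨ parent (site i) = some (site j)) :
    M.det = ∏ x ∈ univ.image site, (M.toSquareBlock site x).det := by
  classical
  -- the block map: (rank, enumeration) of the site, read in the ORDER DUAL of the lexicographic order (Mathlib's `BlockTriangular` is upper-triangular)
  set e : σ ≃ Fin (Fintype.card σ) := Fintype.equivFin σ with he
  set φ : σ → (Lex (ℕ × Fin (Fintype.card σ)))ᵒᵈ := fun x => OrderDual.toDual (toLex (rk x, e x)) with hφ
  have hφinj : Function.Injective φ := by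
    intro x y hxy
    have h := congrArg (fun z => (ofLex (OrderDual.ofDual z)).2) hxy
    exact e.injective h
  set b : t → (Lex (ℕ × Fin (Fintype.card σ)))ᵒᵈ := fun i => φ (site i) with hb
  -- `M` is block triangular for `b`
  have hM : M.BlockTriangular b := by
    intro i j hij
    by_contra hne
    rcases hloc i j hne with h | h
    · exact (ne_of_lt hij) (by rw [hb]; simp only [h])
    · have hlt : rk (site j) < rk (site i) := hrk _ _ h
      -- `b j < b i` means `toLex (rk (site i), _) < toLex (rk (site j), _)`, contradicting `rk (site j) < rk (site i)`
      have hij' : toLex (rk (site i), e (site i)) < toLex (rk (site j), e (site j)) := hij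
      rcases Prod.Lex.lt_iff.1 hij' with h1 | ⟨h1, -⟩
      · exact lt_asymm h1 hlt
      · exact (ne_of_lt hlt) h1.symm
  rw [hM.det]
  -- re-index the product: the level sets of `b` are the sites
  have himg : (univ : Finset t).image b = ((univ : Finset t).image site).image φ := by
    rw [Finset.image_image]; rfl
  rw [himg, Finset.prod_image fun x _ y _ h => hφinj h]
  refine Finset.prod_congr rfl fun x _ => ?_
  -- the `b`-block at `φ x` IS the site block at `x`
  exact equiv_block_det M fun k => (hφinj.eq_iff : φ (site k) = φ x ↔ site k = x).symm

/-- [folklore] **UNIMODULAR SITE BLOCKS ⇒ UNIMODULAR DETERMINANT** (over `ℝ`): under the forest hypotheses, `|det(site block)| = 1` for every site gives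
`|M.det| = 1` (THEOREM R (4): «one contour per x ⇒ the diagonal block is a single `−Ad(h)^{θ'}`, `|det| = 1`»). -/
theorem abs_det_eq_one_of_forestTriangular (M : Matrix t t ℝ) (site : t → σ) (rk : σ → ℕ) (parent : σ → Option σ)
    (hrk : ∀ x p, parent x = some p → rk p < rk x) (hloc : ∀ i j, M i j ≠ 0 → site j = site i ∨ parent (site i) = some (site j))
    (hdiag : ∀ x, |(M.toSquareBlock site x).det| = 1) : |M.det| = 1 := by
  rw [det_of_forestTriangular M site rk parent hrk hloc, Finset.abs_prod]
  exact Finset.prod_eq_one fun x _ => hdiag x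

/-- [folklore] **SCALAR PACKAGING** (`t = σ`, one component per site — the colour-stripped literal): `M.det = ∏ x, M x x`. -/
theorem det_of_forestTriangular_scalar (M : Matrix σ σ R) (rk : σ → ℕ) (parent : σ → Option σ) (hrk : ∀ x p, parent x = some p → rk p < rk x)
    (hloc : ∀ x s, M x s ≠ 0 → s = x ∨ parent x = some s) : M.det = ∏ x, M x x := by
  rw [det_of_forestTriangular M id rk parent hrk (fun i j h => hloc i j h), Finset.image_id]
  refine Finset.prod_congr rfl fun x _ => ?_
  haveI : Subsingleton {a : σ // id a = x} := ⟨fun a b => Subtype.ext (a.2.trans b.2.symm)⟩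
  rw [det_eq_elem_of_subsingleton _ ⟨x, rfl⟩]
  rfl

/-- [folklore] **SCALAR PACKAGING, UNIMODULAR**: `|M x x| = 1` for every site ⇒ `|M.det| = 1`. -/
theorem abs_det_eq_one_of_forestTriangular_scalar (M : Matrix σ σ ℝ) (rk : σ → ℕ) (parent : σ → Option σ) (hrk : ∀ x p, parent x = some p → rk p < rk x)
    (hloc : ∀ x s, M x s ≠ 0 → s = x ∨ parent x = some s) (hdiag : ∀ x, |M x x| = 1) : |M.det| = 1 := by
  rw [det_of_forestTriangular_scalar M rk parent hrk hloc, Finset.abs_prod]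
  exact Finset.prod_eq_one fun x _ => hdiag x

/-- [folklore] **THE COLOUR-STRIPPED LATTICE GAUGE ACTION ON THE TREE ROWS** (the literal's instance shape): if the tree row of the bond into `x` is the
signed GRADIENT `M x s = ε x · ([s = x] − [parent x = some s])` (orientation sign `|ε x| = 1`; `(D λ)(b) = λ(b₋) − λ(b₊)` on the bond `b` between `x` and its
parent, `λ = 0` at the centre), then `|M.det| = 1` — the axial ∕ comb gauge is a complete gauge fixing of the residual group, with trivial Faddeev–Popov modulus. -/
theorem abs_det_eq_one_of_gradientRows (M : Matrix σ σ ℝ) (rk : σ → ℕ) (parent : σ → Option σ) (hrk : ∀ x p, parent x = some p → rk p < rk x)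
    (ε : σ → ℝ) (hε : ∀ x, |ε x| = 1) (hM : ∀ x s, M x s = ε x * ((if s = x then 1 else 0) - (if parent x = some s then 1 else 0))) :
    |M.det| = 1 := by
  refine abs_det_eq_one_of_forestTriangular_scalar M rk parent hrk (fun x s h => ?_) (fun x => ?_)
  · by_contra hc
    rw [not_or] at hc
    exact h (by rw [hM, if_neg hc.1, if_neg hc.2, sub_zero, mul_zero])
  · have hx : parent x ≠ some x := fun h => lt_irrefl _ (hrk x x h)
    rw [hM, if_pos rfl, if_neg hx, sub_zero, mul_one]
    exact hε x

variable {κ : Type*} [Fintype κ] [DecidableEq κ]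

/-- [folklore] **PRODUCT PACKAGING** (`t = σ × κ`, a component index `κ` per site — colour, or field∕multiplier legs): the site block at `x` is
`Matrix.of fun a a' => M (x, a) (x, a')` and `M.det = ∏ x, det (site block at x)`. -/
theorem det_of_forestTriangular_prod (M : Matrix (σ × κ) (σ × κ) R) (rk : σ → ℕ) (parent : σ → Option σ) (hrk : ∀ x p, parent x = some p → rk p < rk x)
    (hloc : ∀ x a s a', M (x, a) (s, a') ≠ 0 → s = x ∨ parent x = some s) :
    M.det = ∏ x, (Matrix.of fun a a' => M (x, a) (x, a')).det := by
  by_cases hκ : Nonempty κ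
  · obtain ⟨a₀⟩ := hκ
    have hsurj : (univ : Finset (σ × κ)).image Prod.fst = univ :=
      Finset.eq_univ_of_forall fun x => Finset.mem_image.2 ⟨(x, a₀), Finset.mem_univ _, rfl⟩
    rw [det_of_forestTriangular M Prod.fst rk parent hrk (fun i j h => hloc i.1 i.2 j.1 j.2 h), hsurj]
    refine Finset.prod_congr rfl fun x _ => ?_
    -- the block `{i // i.1 = x}` re-indexed by `κ`
    let ex : κ ≃ {i : σ × κ // i.1 = x} :=
      { toFun := fun a => ⟨(x, a), rfl⟩
        invFun := fun i => i.1.2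
        left_inv := fun a => rfl
        right_inv := fun i => Subtype.ext (Prod.ext i.2.symm rfl) }
    rw [← det_submatrix_equiv_self ex]
    rfl
  · -- no components: both sides are determinants of empty matrices
    haveI : IsEmpty κ := not_nonempty_iff.1 hκ
    simp [det_isEmpty]

/-- [folklore] **PRODUCT PACKAGING, UNIMODULAR**: `|det (site block at x)| = 1` for every site ⇒ `|M.det| = 1` (THEOREM R (4) with colour: the site block is
`−Ad(V₀(b))^{θ'}`, an orthogonal map). -/
theorem abs_det_eq_one_of_forestTriangular_prod (M : Matrix (σ × κ) (σ × κ) ℝ) (rk : σ → ℕ) (parent : σ → Option σ)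
    (hrk : ∀ x p, parent x = some p → rk p < rk x) (hloc : ∀ x a s a', M (x, a) (s, a') ≠ 0 → s = x ∨ parent x = some s)
    (hdiag : ∀ x, |(Matrix.of fun a a' => M (x, a) (x, a')).det| = 1) : |M.det| = 1 := by
  rw [det_of_forestTriangular_prod M rk parent hrk hloc, Finset.abs_prod]
  exact Finset.prod_eq_one fun x _ => hdiag x

end Forest

/-! ## §2 The tree-coordinate slice reads the tree rows of the generator matrix -/

section TreeSlice

variable {R : Type*} [CommRing R]
variable {o t ρ σ : Type*} [Fintype o] [Fintype t] [DecidableEq t] [Fintype σ] [DecidableEq σ]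

/-- [folklore] **THE TREE-COORDINATE SLICE `[0 | 1]` READS THE TREE ROWS**: with the bonds split `o ⊕ t` (non-tree ⊕ tree, cap3's `SaddleInverse` §TreePin packing)
and the generator matrix split by rows `[D_o; D_t]`, `fromCols 0 1 * fromRows D_o D_t = D_t`. -/
theorem treeSlice_mul_fromRows (Do : Matrix o ρ R) (Dt : Matrix t ρ R) :
    fromCols (0 : Matrix t o R) (1 : Matrix t t R) * fromRows Do Dt = Dt := by
  rw [fromCols_mul_fromRows, Matrix.zero_mul, Matrix.one_mul, zero_add]

/-- [folklore] **THEOREM R (4) AT MODEL LEVEL — THE (UNI) SHAPE `|det(τ·D)| = 1`**: if the tree rows `D_t : Matrix t t ℝ` of the generator matrix (rows = tree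
bonds, columns = residual gauge parameters, identified with the tree bonds through «bond into x ↦ x») are triangular along a ranked forest with unimodular site
blocks, then the tree-coordinate slice has Faddeev–Popov determinant of modulus `1`: `|det(fromCols 0 1 * fromRows D_o D_t)| = 1`. -/
theorem abs_det_treeSlice_mul_eq_one (Do : Matrix o t ℝ) (Dt : Matrix t t ℝ) (site : t → σ) (rk : σ → ℕ) (parent : σ → Option σ)
    (hrk : ∀ x p, parent x = some p → rk p < rk x) (hloc : ∀ i j, Dt i j ≠ 0 → site j = site i ∨ parent (site i) = some (site j))
    (hdiag : ∀ x, |(Dt.toSquareBlock site x).det| = 1) :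
    |(fromCols (0 : Matrix t o ℝ) (1 : Matrix t t ℝ) * fromRows Do Dt).det| = 1 := by
  rw [treeSlice_mul_fromRows]
  exact abs_det_eq_one_of_forestTriangular Dt site rk parent hrk hloc hdiag

end TreeSlice

/-! ## §3 Curve form: the shape of the (UNI) hypotheses of the owner's one-shot step law -/

section Curve

open Filter
open scoped Topology

variable {t σ : Type*} [Fintype t] [DecidableEq t] [Fintype σ] [DecidableEq σ]

/-- [folklore] **(UNI) ALONG A BACKGROUND CURVE.**  The owner's `NestedStepLawOneShot.secondVar_oneShot_nestedStepLaw` (p307295) displays the three Faddeev–Popov moduli as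
`∀ᶠ u in 𝓝 0, |det(M u)| = c` for `M u := τ₁ * Matrix.of (D₁ u)`, `τ₂ * Matrix.of (D̄ u)`,
`Matrix.of (P u) * fromCols (Matrix.of (D₂ u)) (Matrix.of (D₁ u))` (STATIC comb slices, moving generators).  If near `0` each `M u` is triangular along ONE
ranked forest (the comb of the blocks — it does not move with the background) with unimodular site blocks,
then `∀ᶠ u in 𝓝 0, |det(M u)| = 1`: the constants are `c₁ = c₂ = c' = 1`.  (The nested product form `|det([τ₂Q₁;τ₁]·[D₂|D₁])| = c₂·c₁` is the owner's
`NestedStepLawOneShot.abs_det_nestedSlice_mul_gauge` over `NestedSliceExchange.det_nestedSlice_mul_gauge'` — not restated here.) -/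
theorem eventually_abs_det_eq_one_of_forestTriangular (M : ℝ → Matrix t t ℝ) (site : t → σ) (rk : σ → ℕ) (parent : σ → Option σ)
    (hrk : ∀ x p, parent x = some p → rk p < rk x)
    (hloc : ∀ᶠ u in 𝓝 (0 : ℝ), ∀ i j, M u i j ≠ 0 → site j = site i ∨ parent (site i) = some (site j))
    (hdiag : ∀ᶠ u in 𝓝 (0 : ℝ), ∀ x, |((M u).toSquareBlock site x).det| = 1) :
    ∀ᶠ u in 𝓝 (0 : ℝ), |(M u).det| = 1 := by
  filter_upwards [hloc, hdiag] with u hu hu'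
  exact abs_det_eq_one_of_forestTriangular (M u) site rk parent hrk hu hu'

/-- [folklore] **(UNI) ALONG A CURVE, COLOUR-STRIPPED LITERAL**: static tree rows of signed-gradient form (`abs_det_eq_one_of_gradientRows`) give the constant modulus `1`
for every `u` — the shape `∀ᶠ u in 𝓝 0, |det(τ * D)| = 1` with nothing moving. -/
theorem eventually_abs_det_eq_one_of_gradientRows (M : Matrix σ σ ℝ) (rk : σ → ℕ) (parent : σ → Option σ) (hrk : ∀ x p, parent x = some p → rk p < rk x)
    (ε : σ → ℝ) (hε : ∀ x, |ε x| = 1) (hM : ∀ x s, M x s = ε x * ((if s = x then 1 else 0) - (if parent x = some s then 1 else 0))) :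
    ∀ᶠ _u in 𝓝 (0 : ℝ), |M.det| = 1 :=
  Filter.Eventually.of_forall fun _ => abs_det_eq_one_of_gradientRows M rk parent hrk ε hε hM

end Curve

end Summit.QuantumFields.BalabanUV.Beta.FP.CombSliceUnimodular
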